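import Literature.Computability.Complexity.PaulPippengerSzemerediTrotter1983Segments
import HarnessLib

/-!
# Records as flat field lists (PPST 1983, §3 — the verifier, part 8)

Literature / complexity toolkit, thirtieth brick of the inline formalization of
Paul–Pippenger–Szemerédi–Trotter 1983 (`PaulPippengerSzemerediTrotter1983.lean`, fact
`PaulEtAl1983_NTIME_not_subset_DTIME`; roadmap Layer 4, machines, part 11). The verifier reads a
record field by field (`takeSeq`, `…Fields.lean`), i.e. through the flat parser
`groups fieldP n` ("`n` fields"); the decoder reads it through the nested parser `recP`
(`…Formats.lean`: a field, `K` groups of seven numbers, a field, `K` groups of two words, the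
end of record). This file relates the two: a parsed record is `9K + 2` fields followed by the
end of record, and every component of the decoded record is the length / the value / the word
of the corresponding field:

* `groups_fieldP_add` (splitting `groups fieldP (a + b)`), `numsP_flat`, `hvP_flat`,
  `groups_numsP_flat`, `groups_hvP_flat`;
* **`recP_flat`**: `recP K ts = some (r, ts') → ∃ ws, groups fieldP (9K+2) ts = some (ws, .stop :: ts') ∧
  ws.length = 9K+2 ∧ r.pc = |ws[0]| ∧ r.ht k = bitsToNat ws[1+7k] ∧ … ∧ r.efrag k = ws[3+7K+2k]`;
* **`entryP_flat`** likewise for entries (`1 + 2K` fields).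

No named fact is introduced (definitions with bodies and theorems only).

## References

* W. J. Paul, N. Pippenger, E. Szemerédi, W. T. Trotter, *On determinism versus non-determinism
  and related problems*, FOCS 1983, 429–438, §3 [PaulEtAl1983].
-/

namespace Literature.Computability.Complexity

open Function

namespace PPSTSpec

/-- The field parser as a group parser (as in `…Fields.lean`). [folklore] -/
def fieldG (ts : List Tok) : Option (List Bool × List Tok) := field ts

/-- Splitting a flat parse. [folklore] -/
theorem groups_fieldP_add : ∀ (a b : ℕ) (ts : List Tok),
    groups fieldG (a + b) ts = (groups fieldG a ts).bind fun p => (groups fieldG b p.2).map fun q => (p.1 ++ q.1, q.2)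
  | 0, b, ts => by
    rw [Nat.zero_add]; simp only [groups, Option.bind_some, List.nil_append]
    rcases groups fieldG b ts with _ | ⟨ws, ts'⟩ <;> rfl
  | a + 1, b, ts => by
    rw [Nat.add_right_comm]
    simp only [groups, Option.bind_eq_bind]
    rcases fieldG ts with _ | ⟨w, ts₁⟩
    · rfl
    · simp only [Option.bind_some]
      rw [groups_fieldP_add a b ts₁]
      rcases groups fieldG a ts₁ with _ | ⟨ws, ts₂⟩
      · rfl
      · simp only [Option.bind_some]
        rcases groups fieldG b ts₂ with _ | ⟨ws', ts₃⟩ <;> rfl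

/-- A number group is seven fields. [folklore] -/
theorem numsP_flat {ts : List Tok} {g : Nums} {ts' : List Tok} (h : numsP ts = some (g, ts')) :
    ∃ ws : List (List Bool), groups fieldG 7 ts = some (ws, ts') ∧ ∃ w₁ w₂ w₃ w₄ w₅ w₆ w₇,
      ws = [w₁, w₂, w₃, w₄, w₅, w₆, w₇] ∧
      g = ⟨bitsToNat w₁, bitsToNat w₂, bitsToNat w₃, bitsToNat w₄, bitsToNat w₅, bitsToNat w₆, bitsToNat w₇⟩ := by
  simp only [numsP, Option.bind_eq_bind, Option.bind_eq_some_iff, Prod.exists, Option.some.injEq, Prod.mk.injEq] at h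
  obtain ⟨w₁, t₁, h₁, w₂, t₂, h₂, w₃, t₃, h₃, w₄, t₄, h₄, w₅, t₅, h₅, w₆, t₆, h₆, w₇, t₇, h₇, rfl, rfl⟩ := h
  refine ⟨[w₁, w₂, w₃, w₄, w₅, w₆, w₇], ?_, w₁, w₂, w₃, w₄, w₅, w₆, w₇, rfl, rfl⟩
  simp [groups, fieldG, h₁, h₂, h₃, h₄, h₅, h₆, h₇]

/-- A heavy group is two fields. [folklore] -/
theorem hvP_flat {ts : List Tok} {g : Hv} {ts' : List Tok} (h : hvP ts = some (g, ts')) :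
    ∃ ws : List (List Bool), groups fieldG 2 ts = some (ws, ts') ∧ ∃ w₁ w₂, ws = [w₁, w₂] ∧ g = ⟨w₁, w₂⟩ := by
  simp only [hvP, Option.bind_eq_bind, Option.bind_eq_some_iff, Prod.exists, Option.some.injEq, Prod.mk.injEq] at h
  obtain ⟨w₁, t₁, h₁, w₂, t₂, h₂, rfl, rfl⟩ := h
  refine ⟨[w₁, w₂], ?_, w₁, w₂, rfl, rfl⟩
  simp [groups, fieldG, h₁, h₂]

/-- `K` number groups are `7K` fields, group `k` at positions `7k … 7k+6`. [folklore] -/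
theorem groups_numsP_flat : ∀ (n : ℕ) {ts : List Tok} {ns : List Nums} {ts' : List Tok},
    groups numsP n ts = some (ns, ts') →
    ∃ ws : List (List Bool), groups fieldG (n * 7) ts = some (ws, ts') ∧ ws.length = n * 7 ∧ ns.length = n ∧
      ∀ k, k < n → ns[k]? =
        some ⟨bitsToNat (ws.getD (7 * k) []), bitsToNat (ws.getD (7 * k + 1) []), bitsToNat (ws.getD (7 * k + 2) []),
         bitsToNat (ws.getD (7 * k + 3) []), bitsToNat (ws.getD (7 * k + 4) []), bitsToNat (ws.getD (7 * k + 5) []),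
         bitsToNat (ws.getD (7 * k + 6) [])⟩
  | 0, ts, ns, ts', h => by
    simp only [groups, Option.some.injEq, Prod.mk.injEq] at h
    obtain ⟨rfl, rfl⟩ := h
    exact ⟨[], rfl, rfl, rfl, fun k hk => absurd hk (Nat.not_lt_zero k)⟩
  | n + 1, ts, ns, ts', h => by
    simp only [groups, Option.bind_eq_bind, Option.bind_eq_some_iff, Prod.exists] at h
    obtain ⟨g, ts₁, h1, ns', ts₂, h2, h3⟩ := h
    simp only [Option.some.injEq, Prod.mk.injEq] at h3
    obtain ⟨rfl, rfl⟩ := h3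
    obtain ⟨ws₁, hg₁, w₁, w₂, w₃, w₄, w₅, w₆, w₇, rfl, rfl⟩ := numsP_flat h1
    obtain ⟨ws₂, hg₂, hlen₂, hns, hrest⟩ := groups_numsP_flat n h2
    refine ⟨[w₁, w₂, w₃, w₄, w₅, w₆, w₇] ++ ws₂, ?_, by simp [hlen₂]; ring, by simp [hns], fun k hk => ?_⟩
    · rw [show (n + 1) * 7 = 7 + n * 7 by ring, groups_fieldP_add, hg₁, Option.bind_some, hg₂]; rfl
    · cases k with
      | zero => simp
      | succ k =>
        have hk' : k < n := by omega
        have := hrest k hk'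
        simp only [List.getElem?_cons_succ]
        rw [this]
        have e : ∀ j : ℕ, ([w₁, w₂, w₃, w₄, w₅, w₆, w₇] ++ ws₂).getD (7 * (k + 1) + j) [] = ws₂.getD (7 * k + j) [] := by
          intro j
          rw [List.getD_eq_getElem?_getD, List.getD_eq_getElem?_getD, List.getElem?_append_right (by simp; omega)]
          congr 2; simp; omega
        have e0 := e 0
        simp only [Nat.add_zero] at e0
        rw [e0, e 1, e 2, e 3, e 4, e 5, e 6]

/-- `K` heavy groups are `2K` fields, group `k` at positions `2k, 2k+1`. [folklore] -/
theorem groups_hvP_flat : ∀ (n : ℕ) {ts : List Tok} {hs : List Hv} {ts' : List Tok},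
    groups hvP n ts = some (hs, ts') →
    ∃ ws : List (List Bool), groups fieldG (n * 2) ts = some (ws, ts') ∧ ws.length = n * 2 ∧ hs.length = n ∧
      ∀ k, k < n → hs[k]? = some ⟨ws.getD (2 * k) [], ws.getD (2 * k + 1) []⟩
  | 0, ts, hs, ts', h => by
    simp only [groups, Option.some.injEq, Prod.mk.injEq] at h
    obtain ⟨rfl, rfl⟩ := h
    exact ⟨[], rfl, rfl, rfl, fun k hk => absurd hk (Nat.not_lt_zero k)⟩
  | n + 1, ts, hs, ts', h => by
    simp only [groups, Option.bind_eq_bind, Option.bind_eq_some_iff, Prod.exists] at h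
    obtain ⟨g, ts₁, h1, hs', ts₂, h2, h3⟩ := h
    simp only [Option.some.injEq, Prod.mk.injEq] at h3
    obtain ⟨rfl, rfl⟩ := h3
    obtain ⟨ws₁, hg₁, w₁, w₂, rfl, rfl⟩ := hvP_flat h1
    obtain ⟨ws₂, hg₂, hlen₂, hns, hrest⟩ := groups_hvP_flat n h2
    refine ⟨[w₁, w₂] ++ ws₂, ?_, by simp [hlen₂]; ring, by simp [hns], fun k hk => ?_⟩
    · rw [show (n + 1) * 2 = 2 + n * 2 by ring, groups_fieldP_add, hg₁, Option.bind_some, hg₂]; rfl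
    · cases k with
      | zero => simp
      | succ k =>
        have hk' : k < n := by omega
        have := hrest k hk'
        simp only [List.getElem?_cons_succ]
        rw [this]
        have e : ∀ j : ℕ, ([w₁, w₂] ++ ws₂).getD (2 * (k + 1) + j) [] = ws₂.getD (2 * k + j) [] := by
          intro j
          rw [List.getD_eq_getElem?_getD, List.getD_eq_getElem?_getD, List.getElem?_append_right (by simp; omega)]
          congr 2; simp; omega
        have e0 := e 0
        simp only [Nat.add_zero] at e0
        rw [e0, e 1]

/-- **A record is `9K + 2` fields and the end of record; its decoded components are the
length / values / words of the corresponding fields.** [folklore] -/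
theorem recP_flat (K : ℕ) {ts : List Tok} {r : Rec K} {ts' : List Tok} (h : recP K ts = some (r, ts')) :
    ∃ ws : List (List Bool), groups fieldG (9 * K + 2) ts = some (ws, .stop :: ts') ∧ ws.length = 9 * K + 2 ∧
      r.pc = (ws.getD 0 []).length ∧
      (∀ k : Fin K, r.ht k = bitsToNat (ws.getD (1 + 7 * k.val) []) ∧ r.mn k = bitsToNat (ws.getD (1 + 7 * k.val + 1) []) ∧
        r.mx k = bitsToNat (ws.getD (1 + 7 * k.val + 2) []) ∧ r.lo k = bitsToNat (ws.getD (1 + 7 * k.val + 3) []) ∧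
        r.hi k = bitsToNat (ws.getD (1 + 7 * k.val + 4) []) ∧ r.cut k = bitsToNat (ws.getD (1 + 7 * k.val + 5) []) ∧
        r.hib k = bitsToNat (ws.getD (1 + 7 * k.val + 6) [])) ∧
      r.jbit = !(ws.getD (1 + 7 * K) []).isEmpty ∧
      (∀ k : Fin K, r.frag k = ws.getD (2 + 7 * K + 2 * k.val) [] ∧ r.efrag k = ws.getD (2 + 7 * K + 2 * k.val + 1) []) := by
  simp only [recP, Option.bind_eq_bind, Option.bind_eq_some_iff, Prod.exists] at h
  obtain ⟨pcw, t₁, h₁, ns, t₂, h₂, jb, t₃, h₃, hs, t₄, h₄, h₅⟩ := h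
  rcases t₄ with _ | ⟨_ | _ | _, ts''⟩
  · simp at h₅
  · simp at h₅
  · simp at h₅
  simp only [Option.some.injEq, Prod.mk.injEq] at h₅
  obtain ⟨rfl, rfl⟩ := h₅
  obtain ⟨wsN, hgN, hlenN, hnsl, hN⟩ := groups_numsP_flat K h₂
  obtain ⟨wsH, hgH, hlenH, hhsl, hH⟩ := groups_hvP_flat K h₄
  have getD_ns : ∀ k : Fin K, ns.getD k.val default =
      ⟨bitsToNat (wsN.getD (7 * k.val) []), bitsToNat (wsN.getD (7 * k.val + 1) []), bitsToNat (wsN.getD (7 * k.val + 2) []),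
       bitsToNat (wsN.getD (7 * k.val + 3) []), bitsToNat (wsN.getD (7 * k.val + 4) []), bitsToNat (wsN.getD (7 * k.val + 5) []),
       bitsToNat (wsN.getD (7 * k.val + 6) [])⟩ := fun k => by
    rw [List.getD_eq_getElem?_getD, hN k.val k.isLt]; rfl
  have getD_hs : ∀ k : Fin K, hs.getD k.val default = ⟨wsH.getD (2 * k.val) [], wsH.getD (2 * k.val + 1) []⟩ := fun k => by
    rw [List.getD_eq_getElem?_getD, hH k.val k.isLt]; rfl
  refine ⟨[pcw] ++ wsN ++ [jb] ++ wsH, ?_, by simp [hlenN, hlenH]; ring, by simp [mkRec], fun k => ?_, ?_, fun k => ?_⟩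
  · rw [show 9 * K + 2 = 1 + (K * 7 + (1 + K * 2)) by ring, groups_fieldP_add,
      show groups fieldG 1 ts = some ([pcw], t₁) by simp [groups, fieldG, h₁], Option.bind_some, groups_fieldP_add, hgN,
      Option.bind_some, groups_fieldP_add, show groups fieldG 1 t₂ = some ([jb], t₃) by simp [groups, fieldG, h₃],
      Option.bind_some, hgH]
    simp
  · -- numbers of stack `k`
    have eget : ∀ j : ℕ, j < 7 → ([pcw] ++ wsN ++ [jb] ++ wsH).getD (1 + 7 * k.val + j) [] = wsN.getD (7 * k.val + j) [] := by
      intro j hj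
      have hlt : 7 * k.val + j < wsN.length := by rw [hlenN]; have := k.isLt; nlinarith
      rw [List.getD_eq_getElem?_getD, List.getD_eq_getElem?_getD, List.append_assoc, List.append_assoc,
        List.getElem?_append_right (by simp; omega)]
      simp only [List.length_singleton, show 1 + 7 * k.val + j - 1 = 7 * k.val + j by omega]
      rw [List.getElem?_append_left hlt]
    have e0 := eget 0 (by norm_num)
    simp only [Nat.add_zero] at e0
    simp only [mkRec, getD_ns k, e0, eget 1 (by norm_num), eget 2 (by norm_num), eget 3 (by norm_num),
      eget 4 (by norm_num), eget 5 (by norm_num), eget 6 (by norm_num), and_self]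
  · -- the `J` bit
    simp only [mkRec]
    have e : ([pcw] ++ wsN ++ [jb] ++ wsH).getD (1 + 7 * K) [] = jb := by
      rw [List.getD_eq_getElem?_getD, List.append_assoc, List.append_assoc, List.getElem?_append_right (by simp)]
      simp only [List.length_singleton, show 1 + 7 * K - 1 = 7 * K by omega, List.singleton_append]
      rw [List.getElem?_append_right (show wsN.length ≤ 7 * K by rw [hlenN]; omega)]
      simp [hlenN, show 7 * K - K * 7 = 0 by omega]
    rw [e]
  · -- heavy words of stack `k`
    have eget : ∀ j : ℕ, j < 2 → ([pcw] ++ wsN ++ [jb] ++ wsH).getD (2 + 7 * K + 2 * k.val + j) [] = wsH.getD (2 * k.val + j) [] := by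
      intro j hj
      rw [List.getD_eq_getElem?_getD, List.getD_eq_getElem?_getD,
        List.getElem?_append_right (by simp [hlenN]; omega)]
      congr 2; simp [hlenN]; omega
    have e0 := eget 0 (by norm_num)
    simp only [Nat.add_zero] at e0
    simp only [mkRec, getD_hs k, e0, eget 1 (by norm_num), and_self]

/-- An entry group is six fields. [folklore] -/
theorem egP_flat {ts : List Tok} {g : Eg} {ts' : List Tok} (h : egP ts = some (g, ts')) :
    ∃ ws : List (List Bool), groups fieldG 6 ts = some (ws, ts') ∧ ∃ w₁ w₂ w₃ w₄ w₅ w₆,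
      ws = [w₁, w₂, w₃, w₄, w₅, w₆] ∧ g = ⟨w₁, w₂, bitsToNat w₃, bitsToNat w₄, bitsToNat w₅, bitsToNat w₆⟩ := by
  simp only [egP, Option.bind_eq_bind, Option.bind_eq_some_iff, Prod.exists, Option.some.injEq, Prod.mk.injEq] at h
  obtain ⟨w₁, t₁, h₁, w₂, t₂, h₂, w₃, t₃, h₃, w₄, t₄, h₄, w₅, t₅, h₅, w₆, t₆, h₆, rfl, rfl⟩ := h
  refine ⟨[w₁, w₂, w₃, w₄, w₅, w₆], ?_, w₁, w₂, w₃, w₄, w₅, w₆, rfl, rfl⟩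
  simp [groups, fieldG, h₁, h₂, h₃, h₄, h₅, h₆]

/-- `K` entry groups are `6K` fields, group `k` at positions `6k … 6k+5`. [folklore] -/
theorem groups_egP_flat : ∀ (n : ℕ) {ts : List Tok} {gs : List Eg} {ts' : List Tok},
    groups egP n ts = some (gs, ts') →
    ∃ ws : List (List Bool), groups fieldG (n * 6) ts = some (ws, ts') ∧ ws.length = n * 6 ∧ gs.length = n ∧
      ∀ k, k < n → gs[k]? =
        some ⟨ws.getD (6 * k) [], ws.getD (6 * k + 1) [], bitsToNat (ws.getD (6 * k + 2) []),
          bitsToNat (ws.getD (6 * k + 3) []), bitsToNat (ws.getD (6 * k + 4) []), bitsToNat (ws.getD (6 * k + 5) [])⟩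
  | 0, ts, gs, ts', h => by
    simp only [groups, Option.some.injEq, Prod.mk.injEq] at h
    obtain ⟨rfl, rfl⟩ := h
    exact ⟨[], rfl, rfl, rfl, fun k hk => absurd hk (Nat.not_lt_zero k)⟩
  | n + 1, ts, gs, ts', h => by
    simp only [groups, Option.bind_eq_bind, Option.bind_eq_some_iff, Prod.exists] at h
    obtain ⟨g, ts₁, h1, gs', ts₂, h2, h3⟩ := h
    simp only [Option.some.injEq, Prod.mk.injEq] at h3
    obtain ⟨rfl, rfl⟩ := h3
    obtain ⟨ws₁, hg₁, w₁, w₂, w₃, w₄, w₅, w₆, rfl, rfl⟩ := egP_flat h1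
    obtain ⟨ws₂, hg₂, hlen₂, hns, hrest⟩ := groups_egP_flat n h2
    refine ⟨[w₁, w₂, w₃, w₄, w₅, w₆] ++ ws₂, ?_, by simp [hlen₂]; ring, by simp [hns], fun k hk => ?_⟩
    · rw [show (n + 1) * 6 = 6 + n * 6 by ring, groups_fieldP_add, hg₁, Option.bind_some, hg₂]; rfl
    · cases k with
      | zero => simp
      | succ k =>
        have hk' : k < n := by omega
        have := hrest k hk'
        simp only [List.getElem?_cons_succ]
        rw [this]
        have e : ∀ j : ℕ, ([w₁, w₂, w₃, w₄, w₅, w₆] ++ ws₂).getD (6 * (k + 1) + j) [] = ws₂.getD (6 * k + j) [] := by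
          intro j
          rw [List.getD_eq_getElem?_getD, List.getD_eq_getElem?_getD, List.getElem?_append_right (by simp; omega)]
          congr 2; simp; omega
        have e0 := e 0
        simp only [Nat.add_zero] at e0
        rw [e0, e 1, e 2, e 3, e 4, e 5]

/-- **An entry is `1 + 6K` fields and the end of record; its decoded components are the values /
words of the corresponding fields.** [folklore] -/
theorem entryP_flat (K : ℕ) {ts : List Tok} {en : Entry K} {ts' : List Tok} (h : entryP K ts = some (en, ts')) :
    ∃ ws : List (List Bool), groups fieldG (1 + 6 * K) ts = some (ws, .stop :: ts') ∧ ws.length = 1 + 6 * K ∧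
      en.u = bitsToNat (ws.getD 0 []) ∧
      (∀ k : Fin K, en.frag k = ws.getD (1 + 6 * k.val) [] ∧ en.efrag k = ws.getD (1 + 6 * k.val + 1) [] ∧
        en.lt k false = bitsToNat (ws.getD (1 + 6 * k.val + 2) []) ∧
        en.lt k true = bitsToNat (ws.getD (1 + 6 * k.val + 3) []) ∧
        en.ptr k false = bitsToNat (ws.getD (1 + 6 * k.val + 4) []) ∧
        en.ptr k true = bitsToNat (ws.getD (1 + 6 * k.val + 5) [])) := by
  simp only [entryP, Option.bind_eq_bind, Option.bind_eq_some_iff, Prod.exists] at h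
  obtain ⟨uw, t₁, h₁, gs, t₂, h₂, h₃⟩ := h
  rcases t₂ with _ | ⟨_ | _ | _, ts''⟩
  · simp at h₃
  · simp at h₃
  · simp at h₃
  simp only [Option.some.injEq, Prod.mk.injEq] at h₃
  obtain ⟨rfl, rfl⟩ := h₃
  obtain ⟨wsG, hgG, hlenG, hgsl, hG⟩ := groups_egP_flat K h₂
  have getD_gs : ∀ k : Fin K, gs.getD k.val default =
      ⟨wsG.getD (6 * k.val) [], wsG.getD (6 * k.val + 1) [], bitsToNat (wsG.getD (6 * k.val + 2) []),
        bitsToNat (wsG.getD (6 * k.val + 3) []), bitsToNat (wsG.getD (6 * k.val + 4) []),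
        bitsToNat (wsG.getD (6 * k.val + 5) [])⟩ := fun k => by
    rw [List.getD_eq_getElem?_getD, hG k.val k.isLt]; rfl
  refine ⟨[uw] ++ wsG, ?_, by simp [hlenG]; ring, by simp, fun k => ?_⟩
  · rw [show 1 + 6 * K = 1 + K * 6 by ring, groups_fieldP_add,
      show groups fieldG 1 ts = some ([uw], t₁) by simp [groups, fieldG, h₁], Option.bind_some, hgG]
    simp
  · have eget : ∀ j : ℕ, j < 6 → ([uw] ++ wsG).getD (1 + 6 * k.val + j) [] = wsG.getD (6 * k.val + j) [] := by
      intro j hj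
      rw [List.getD_eq_getElem?_getD, List.getD_eq_getElem?_getD, List.getElem?_append_right (by simp; omega)]
      simp only [List.length_singleton, show 1 + 6 * k.val + j - 1 = 6 * k.val + j by omega]
    have e0 := eget 0 (by norm_num)
    simp only [Nat.add_zero] at e0
    simp only [getD_gs k, e0, eget 1 (by norm_num), eget 2 (by norm_num), eget 3 (by norm_num),
      eget 4 (by norm_num), eget 5 (by norm_num), Bool.false_eq_true, if_false, if_true, and_self]

end PPSTSpec

end Literature.Computability.Complexity
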